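/-
Copyright: the b2b-balaban T⁴-continuum CRUX team, row NE7b OWNER lineage `t4-ne7b-p1` (gen 128). Project licence.
-/
import Summits.QuantumFields.BalabanUV.T4Continuum.Spine.NE7b.SupRegulatedActivityBound

/-!
# THE ACTIVITIES ARE REGULATED FUNCTIONALS OF THE EXTERNAL FIELD: shifting regulated cell factors by an external (coarser-scale ∕
# background) field `ψ` keeps them regulated in the fluctuation field at strength `κ(1+τ)` at the price `e^{½κ(1+τ⁻¹)Σ_{x∈cell p}ψ_x²}`
# (Young's inequality, any `τ > 0`), so over `N(0,Γ)` (`Γ ⪯ γ_op·1`, diagonal `≤ γ`, `κ(1+τ)γ_op ≤ θ < 1`) the SHIFTED activities obey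
# `‖M_ψ(K)‖ ≤ (εA_τ^v)^{#K}·e^{½κ(1+τ⁻¹)Σ_{x∈⋃_K cells}ψ_x²}` for EVERY `ψ` — regulated in `ψ` on their own cells — and where the external
# field is SMALL on cells (`Σ_{x∈cell p}ψ_x² ≤ Ψ²`) the shifted perturbation is again a zero-free polymer gas with
# `‖log Z_ψ(C)‖ ≤ #C(Δ+1)2e·εe^{½κ(1+τ⁻¹)Ψ²}A_τ^v`, uniformly in the volume AND in such `ψ` (row NE7b, node U5c; (289) BY NAME + Young;
# [folklore])

Cell `pub-balaban`, sub-cell `t4`, spine estimate NE7b (`T4WeightBudget.RelWeightBound`; the cell's OWN estimate — NOT PRINTED in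
[Bałaban 1983–89], NOT PROVED).  Crux-route work under `Spine/NE7b/` by the row OWNER (`t4-ne7b-p1` gen 128, file (292)) under FREEZE
(0)'s crux-prover clause, on § [NE7bP1-G127-HANDOFF] NEXT (3)(b)∕(e); NOTHING of Bałaban's is named as a Lean object, valued or asserted; no
`T4Continuum/Support` leaf typed; no `def`, no notation; zero `sorry`.  Imports (BY NAME): the OWNER's (289) `…SupRegulatedActivityBound`
(`norm_cellActivity_le_of_regulated`, `regulated_pertZ_eq_polymerPartitionFunction`, `regulated_pertZ_ne_zero`, `regulated_norm_pertLogZ_le`).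

WHY (located).  One step of the road integrates the scale-`N` fluctuation field `ζ` with the factors evaluated at `ζ + ψ`, `ψ` = the
coarser fields + the background; the output must be a functional of `ψ` with CONTROLLED growth, to be fed to the next step.  The exact
statement is the tree's renormalised regulator (`GaussianQuadraticTilt.norm_integral_shift_le_of_norm_le_exp`: regulator `M ↦ M(1−ΓM)⁻¹`);
this file types the elementary form that the polymer gas consumes: by `(a+b)² ≤ (1+τ)a² + (1+τ⁻¹)b²` the shifted factor is regulated in
`ζ` (strength `κ(1+τ)`, integrated by (289)) times a regulator in `ψ` (strength `κ(1+τ⁻¹)`) living on the SAME cell — so the activities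
inherit a cell-local quadratic regulator in the external field, and on the region where `ψ` is small on cells the expansion converges
exactly as before.  The complement — cells where the external field is large — is where Bałaban's large-field REGIONS enter (not here).

WHAT IS PROVED ([folklore]; `μ = multivariateGaussian 0 Γ`, cells `cell : V → Finset ι`, shifted factors `ω ↦ g_p(ω + ψ)`):
* §1 `young_sq` (`(a+b)² ≤ (1+τ)a² + (1+τ⁻¹)b²`), `sum_add_sq_le` (summed over a cell);
* §2 **`shifted_regulated`** (`‖g_p(ω)‖ ≤ εe^{½κΣ_pω²}`, `ε, κ ≥ 0` ⟹ `‖g_p(ω+ψ)‖ ≤ (εe^{½κ(1+τ⁻¹)Σ_pψ²})·e^{½κ(1+τ)Σ_pω²}`),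
  `shifted_regulated_of_small` (`Σ_{x∈cell p}ψ_x² ≤ Ψ²` on every cell ⟹ constant `ε_Ψ = εe^{½κ(1+τ⁻¹)Ψ²}`);
* §3 `cellActivity_mul_const` (cell constants factor out of activities), **`shifted_norm_cellActivity_le`** (for EVERY `ψ`:
  `‖M_ψ(K)‖ ≤ (εA_τ^v)^{#K}·e^{½κ(1+τ⁻¹)Σ_{x∈⋃_{p∈K}cell p}ψ_x²}`, `A_τ = (1−θ)^{−κ(1+τ)γ∕(2θ)}` — no measurability, no smallness of `ψ`);
* §4 `shifted_measurable` (cell-measurability is shift-invariant), THE END on the small-external-field region: **`shifted_pertZ_ne_zero`**,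
  **`shifted_norm_pertLogZ_le`** (`‖log Z_ψ(C)‖ ≤ #C(Δ+1)2e·ε_ΨA_τ^v` under `e·ε_ΨA_τ^v·(Δ+1)² ≤ 1∕2`, uniformly in `C` and in `ψ` with
  `Σ_{cell p}ψ² ≤ Ψ²` for all `p`); §5 toy.

HONEST (what this is NOT).  Young's inequality instead of the exact renormalised regulator `M(1−ΓM)⁻¹` (looser constants: strength
`κ(1+τ⁻¹)` in `ψ` instead of `κ∕(1−θ)`); the large-external-field cells are only BOUNDED (§3), not organised into regions; one scale; scalar
skeleton ((A3), NC-NE7b-α UNRULED); nothing of Bałaban's asserted.  BY-NAME EFFECT ON THE WALL: NONE.  NE7b NOT PRINTED ∕ NOT PROVED; spine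
PROVED 0∕9; rung (B)+1 — the programme's measures remain FINITE-torus statements; NOT the mass gap, NOT Clay.  HONEST DEPENDENCY: continuum YM
on T⁴ ⇐ BetaPertH ∧ nine spine estimates (0∕9 proved); BetaPertH ⇐ (D1) ∧ (D4) ∧ CAP+tail; G-an2-4 gates asym, D1 and NE2∕3∕4.
-/

set_option autoImplicit false

noncomputable section

namespace Summit.QuantumFields.BalabanUV.T4Continuum.NE7b.SupRegulatedActivityShift

open MeasureTheory ProbabilityTheory Finset Real
open scoped BigOperators
open Literature.Probability.LatticeModels (Touches GeomInc IsRConnected pertZ cellActivity pertLogZ rconnSubsets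
  polymerPartitionFunction)
open Literature.Analysis.Matrix (HasFiniteRange)
open SupRegulatedActivityBound

variable {ι : Type} [Fintype ι] [DecidableEq ι] {V : Type*}

/-! ## §1. Young's inequality on a cell -/

/-- **Young**: `(a+b)² ≤ (1+τ)a² + (1+τ⁻¹)b²` for `τ > 0` (the difference is `(τa − b)²∕τ`). [folklore] -/
theorem young_sq (a b : ℝ) {τ : ℝ} (hτ : 0 < τ) : (a + b) ^ 2 ≤ (1 + τ) * a ^ 2 + (1 + τ⁻¹) * b ^ 2 := by
  have h : (1 + τ) * a ^ 2 + (1 + τ⁻¹) * b ^ 2 - (a + b) ^ 2 = (τ * a - b) ^ 2 / τ := by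
    field_simp
    ring
  have h0 : 0 ≤ (τ * a - b) ^ 2 / τ := div_nonneg (sq_nonneg _) hτ.le
  linarith

omit [Fintype ι] [DecidableEq ι] in
/-- Young summed over a cell: `Σ_{x∈p}(ζ_x+ψ_x)² ≤ (1+τ)Σ_{x∈p}ζ_x² + (1+τ⁻¹)Σ_{x∈p}ψ_x²`. [folklore] -/
theorem sum_add_sq_le (P : Finset ι) (ζ ψ : ι → ℝ) {τ : ℝ} (hτ : 0 < τ) :
    ∑ x ∈ P, (ζ x + ψ x) ^ 2 ≤ (1 + τ) * ∑ x ∈ P, ζ x ^ 2 + (1 + τ⁻¹) * ∑ x ∈ P, ψ x ^ 2 := by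
  rw [mul_sum, mul_sum, ← sum_add_distrib]
  exact sum_le_sum fun x _ => young_sq (ζ x) (ψ x) hτ

/-! ## §2. Shifted regulated factors are regulated -/

omit [Fintype ι] [DecidableEq ι] in
/-- **SHIFTING A REGULATED FACTOR**: `‖g_p(ω)‖ ≤ ε·e^{½κΣ_{x∈cell p}ω_x²}` for all `ω` (`0 ≤ κ`, `0 < τ`) ⟹ for every external field `ψ`
and every `ω`: `‖g_p(ω + ψ)‖ ≤ (ε·e^{½κ(1+τ⁻¹)Σ_{x∈cell p}ψ_x²}) · e^{½κ(1+τ)Σ_{x∈cell p}ω_x²}`. [folklore] -/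
theorem shifted_regulated (cell : V → Finset ι) {g : V → EuclideanSpace ℝ ι → ℂ} {ε κ τ : ℝ} (hε : 0 ≤ ε) (hκ : 0 ≤ κ) (hτ : 0 < τ)
    (hreg : ∀ p ω, ‖g p ω‖ ≤ ε * exp (κ * (∑ x ∈ cell p, ω x ^ 2) / 2)) (p : V) (ψ ω : EuclideanSpace ℝ ι) :
    ‖g p (ω + ψ)‖ ≤ (ε * exp (κ * (1 + τ⁻¹) * (∑ x ∈ cell p, ψ x ^ 2) / 2)) *
      exp (κ * (1 + τ) * (∑ x ∈ cell p, ω x ^ 2) / 2) := by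
  have h := hreg p (ω + ψ)
  have hsum : ∑ x ∈ cell p, (ω + ψ) x ^ 2 = ∑ x ∈ cell p, (ω x + ψ x) ^ 2 :=
    sum_congr rfl fun x _ => by simp only [WithLp.ofLp_add, Pi.add_apply]
  rw [hsum] at h
  have hy := sum_add_sq_le (cell p) (fun x => ω x) (fun x => ψ x) hτ
  refine h.trans ?_
  rw [mul_assoc, ← exp_add]
  refine mul_le_mul_of_nonneg_left (exp_le_exp.2 ?_) hε
  have := mul_le_mul_of_nonneg_left hy hκ
  nlinarith [this]

omit [Fintype ι] [DecidableEq ι] in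
/-- **On the small-external-field region the shifted factors are regulated with a CONSTANT**: if `Σ_{x∈cell p}ψ_x² ≤ Ψ²` for every cell then
`‖g_p(ω + ψ)‖ ≤ (εe^{½κ(1+τ⁻¹)Ψ²})·e^{½κ(1+τ)Σ_{x∈cell p}ω_x²}`. [folklore] -/
theorem shifted_regulated_of_small (cell : V → Finset ι) {g : V → EuclideanSpace ℝ ι → ℂ} {ε κ τ Ψ : ℝ} (hε : 0 ≤ ε) (hκ : 0 ≤ κ)
    (hτ : 0 < τ) (hreg : ∀ p ω, ‖g p ω‖ ≤ ε * exp (κ * (∑ x ∈ cell p, ω x ^ 2) / 2)) (ψ : EuclideanSpace ℝ ι)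
    (hψ : ∀ p, ∑ x ∈ cell p, ψ x ^ 2 ≤ Ψ ^ 2) (p : V) (ω : EuclideanSpace ℝ ι) :
    ‖g p (ω + ψ)‖ ≤ (ε * exp (κ * (1 + τ⁻¹) * Ψ ^ 2 / 2)) * exp (κ * (1 + τ) * (∑ x ∈ cell p, ω x ^ 2) / 2) := by
  refine (shifted_regulated cell hε hκ hτ hreg p ψ ω).trans (mul_le_mul_of_nonneg_right ?_ (exp_pos _).le)
  refine mul_le_mul_of_nonneg_left (exp_le_exp.2 ?_) hε
  have h1 : 0 ≤ κ * (1 + τ⁻¹) := mul_nonneg hκ (by positivity)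
  have := mul_le_mul_of_nonneg_left (hψ p) h1
  linarith

/-! ## §3. The shifted activities are regulated functionals of the external field on their own cells -/

omit [Fintype ι] [DecidableEq ι] in
/-- Cell constants factor out of activities: `∫∏_{p∈K}(c_p·f_p) = (∏_{p∈K}c_p)·∫∏_{p∈K}f_p`. [folklore] -/
theorem cellActivity_mul_const {Ω : Type*} [MeasurableSpace Ω] (μ : Measure Ω) (c : V → ℂ) (f : V → Ω → ℂ) (K : Finset V) :
    cellActivity μ (fun p ω => c p * f p ω) K = (∏ p ∈ K, c p) * cellActivity μ f K := by
  unfold cellActivity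
  rw [← integral_const_mul]
  exact integral_congr_ae (ae_of_all _ fun ω => prod_mul_distrib)

/-- **THE SHIFTED ACTIVITY BOUND, FOR EVERY EXTERNAL FIELD.**  `Γ ⪰ 0`, `Γ ⪯ γ_op·1`, diagonal `≤ γ` (`γ ≥ 0`); disjoint cells of `≤ v`
sites; `‖g_p(ω)‖ ≤ εe^{½κΣ_{cell p}ω²}` (`0 ≤ ε`, `0 ≤ κ`, `0 < τ`, `0 < θ < 1`, `κ(1+τ)γ_op ≤ θ`) ⟹ for EVERY `ψ` and every finite `K`:
`‖∫∏_{p∈K} g_p(ω + ψ) dN(0,Γ)(ω)‖ ≤ (ε·A_τ^v)^{#K} · e^{½κ(1+τ⁻¹)Σ_{x∈⋃_{p∈K}cell p}ψ_x²}`, `A_τ = (1−θ)^{−κ(1+τ)γ∕(2θ)}` — the activity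
is a regulated functional of the external field, with the regulator living on the polymer's own cells. [folklore] -/
theorem shifted_norm_cellActivity_le [DecidableEq V] {Γ : Matrix ι ι ℝ} {γop γ : ℝ} (hΓ : Γ.PosSemidef)
    (hΓop : (γop • (1 : Matrix ι ι ℝ) - Γ).PosSemidef) (hdiag : ∀ i, Γ i i ≤ γ) (hγ : 0 ≤ γ) (cell : V → Finset ι)
    (hdisj : ∀ p q, p ≠ q → Disjoint (cell p) (cell q)) {v : ℕ} (hv : ∀ p, (cell p).card ≤ v)
    {g : V → EuclideanSpace ℝ ι → ℂ} {ε κ τ θ : ℝ} (hε : 0 ≤ ε) (hκ : 0 ≤ κ) (hτ : 0 < τ) (hθ0 : 0 < θ) (hθ1 : θ < 1)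
    (hκθ : κ * (1 + τ) * γop ≤ θ) (hreg : ∀ p ω, ‖g p ω‖ ≤ ε * exp (κ * (∑ x ∈ cell p, ω x ^ 2) / 2))
    (ψ : EuclideanSpace ℝ ι) (K : Finset V) :
    ‖cellActivity (multivariateGaussian 0 Γ) (fun p ω => g p (ω + ψ)) K‖ ≤
      (ε * ((1 - θ) ^ (-(κ * (1 + τ) * γ / (2 * θ)))) ^ v) ^ K.card *
        exp (κ * (1 + τ⁻¹) * (∑ x ∈ K.biUnion cell, ψ x ^ 2) / 2) := by
  have hpd : (K : Set V).PairwiseDisjoint cell := fun p _ q _ hpq => hdisj p q hpq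
  -- the compensated factors `g̃_p(ω) = e^{−½κ(1+τ⁻¹)Σ_pψ²} g_p(ω+ψ)` are regulated with the constant `ε` at strength `κ(1+τ)`
  set c : V → ℂ := fun p => ((exp (-(κ * (1 + τ⁻¹) * (∑ x ∈ cell p, ψ x ^ 2) / 2)) : ℝ) : ℂ) with hc
  have hreg' : ∀ p ω, ‖c p * g p (ω + ψ)‖ ≤ ε * exp (κ * (1 + τ) * (∑ x ∈ cell p, ω x ^ 2) / 2) := by
    intro p ω
    rw [norm_mul, hc, Complex.norm_real, Real.norm_eq_abs, abs_of_pos (exp_pos _)]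
    have h := shifted_regulated cell hε hκ hτ hreg p ψ ω
    have hpos : 0 < exp (κ * (1 + τ⁻¹) * (∑ x ∈ cell p, ψ x ^ 2) / 2) := exp_pos _
    calc exp (-(κ * (1 + τ⁻¹) * (∑ x ∈ cell p, ψ x ^ 2) / 2)) * ‖g p (ω + ψ)‖
        ≤ exp (-(κ * (1 + τ⁻¹) * (∑ x ∈ cell p, ψ x ^ 2) / 2)) *
            ((ε * exp (κ * (1 + τ⁻¹) * (∑ x ∈ cell p, ψ x ^ 2) / 2)) * exp (κ * (1 + τ) * (∑ x ∈ cell p, ω x ^ 2) / 2)) :=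
          mul_le_mul_of_nonneg_left h (exp_pos _).le
      _ = ε * exp (κ * (1 + τ) * (∑ x ∈ cell p, ω x ^ 2) / 2) := by
          rw [Real.exp_neg]
          field_simp
  have hκ' : 0 ≤ κ * (1 + τ) := mul_nonneg hκ (by linarith)
  have hact := norm_cellActivity_le_of_regulated hΓ hΓop hdiag hγ cell hdisj hv (g := fun p ω => c p * g p (ω + ψ)) hε hκ' hθ0 hθ1
    hκθ hreg' K
  -- undo the compensation
  rw [cellActivity_mul_const] at hact
  have hprod : (∏ p ∈ K, c p) = ((exp (-(κ * (1 + τ⁻¹) * (∑ x ∈ K.biUnion cell, ψ x ^ 2) / 2)) : ℝ) : ℂ) := by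
    rw [hc]
    push_cast
    rw [← Complex.exp_sum, sum_biUnion hpd]
    congr 1
    rw [mul_sum, sum_div, ← sum_neg_distrib]
  rw [hprod, norm_mul, Complex.norm_real, Real.norm_eq_abs, abs_of_pos (exp_pos _), Real.exp_neg,
    inv_mul_le_iff₀ (exp_pos _)] at hact
  linarith [hact]

/-! ## §4. THE END on the small-external-field region -/

omit [Fintype ι] [DecidableEq ι] in
/-- **Cell-measurability is shift-invariant**: if `g_p` is `σ(ω|_{cell p})`-measurable, so is `ω ↦ g_p(ω + ψ)` (the restriction of a
shift is the shift of the restriction). [folklore] -/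
theorem shifted_measurable (cell : V → Finset ι) {g : V → EuclideanSpace ℝ ι → ℂ}
    (hmeas : ∀ p, Measurable[MeasurableSpace.comap (fun (ω : EuclideanSpace ℝ ι) (x : cell p) => ω x) inferInstance] (g p))
    (ψ : EuclideanSpace ℝ ι) (p : V) :
    Measurable[MeasurableSpace.comap (fun (ω : EuclideanSpace ℝ ι) (x : cell p) => ω x) inferInstance] (fun ω => g p (ω + ψ)) := by
  set rp : EuclideanSpace ℝ ι → (cell p → ℝ) := fun ω x => ω x with hrp
  -- the shift is measurable from `σ(rp)` to `σ(rp)`: `rp ∘ (· + ψ) = (· + rp ψ) ∘ rp`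
  have hT : Measurable[MeasurableSpace.comap rp inferInstance, MeasurableSpace.comap rp inferInstance]
      (fun ω : EuclideanSpace ℝ ι => ω + ψ) := by
    rw [measurable_iff_comap_le, MeasurableSpace.comap_comp]
    have hcomp : rp ∘ (fun ω : EuclideanSpace ℝ ι => ω + ψ) = (fun f : cell p → ℝ => f + rp ψ) ∘ rp := by
      funext ω
      ext x
      simp [hrp]
    rw [hcomp, ← MeasurableSpace.comap_comp]
    exact MeasurableSpace.comap_mono (measurable_iff_comap_le.1 (measurable_add_const (rp ψ)))
  exact (hmeas p).comp hT

/-- **ZERO-FREENESS OF THE SHIFTED PERTURBATION on the small-external-field region**: `Γ ⪰ 0` of range `ρ`, `Γ ⪯ γ_op·1`, diagonal `≤ γ`;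
disjoint cells of `≤ v` sites, an adjacency covering `ρ`-closeness with `≤ Δ` neighbours; cell-measurable regulated factors; `0 < τ`,
`κ(1+τ)γ_op ≤ θ < 1`; an external field with `Σ_{x∈cell p}ψ_x² ≤ Ψ²` on every cell; `e·ε_ΨA_τ^v·(Δ+1)² ≤ 1∕2` ⟹ `Z_ψ(C) ≠ 0`. [folklore] -/
theorem shifted_pertZ_ne_zero [DecidableEq V] {Γ : Matrix ι ι ℝ} {γop γ : ℝ} (hΓ : Γ.PosSemidef)
    (hΓop : (γop • (1 : Matrix ι ι ℝ) - Γ).PosSemidef) (hdiag : ∀ i, Γ i i ≤ γ) (hγ : 0 ≤ γ) {dι : ι → ι → ℕ} {ρ : ℕ}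
    (hfr : HasFiniteRange dι ρ Γ) (cell : V → Finset ι) (hdisj : ∀ p q, p ≠ q → Disjoint (cell p) (cell q)) {v : ℕ}
    (hv : ∀ p, (cell p).card ≤ v) {R : V → V → Prop} [DecidableRel R] (hRsymm : ∀ x y, R x y → R y x)
    (hR : ∀ (p p' : V) (x y : ι), x ∈ cell p → y ∈ cell p' → dι x y ≤ ρ → p = p' ∨ R p p') {nbr : V → Finset V} {Δ : ℕ}
    (hΔ : ∀ x, (nbr x).card ≤ Δ) (hnbr : ∀ x y, R x y → y ∈ nbr x)
    {g : V → EuclideanSpace ℝ ι → ℂ} {ε κ τ θ Ψ : ℝ} (hε : 0 ≤ ε) (hκ : 0 ≤ κ) (hτ : 0 < τ) (hθ0 : 0 < θ) (hθ1 : θ < 1)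
    (hκθ : κ * (1 + τ) * γop ≤ θ)
    (hmeas : ∀ p, Measurable[MeasurableSpace.comap (fun (ω : EuclideanSpace ℝ ι) (x : cell p) => ω x) inferInstance] (g p))
    (hreg : ∀ p ω, ‖g p ω‖ ≤ ε * exp (κ * (∑ x ∈ cell p, ω x ^ 2) / 2)) (ψ : EuclideanSpace ℝ ι)
    (hψ : ∀ p, ∑ x ∈ cell p, ψ x ^ 2 ≤ Ψ ^ 2)
    (hsmall : Real.exp 1 * ((ε * exp (κ * (1 + τ⁻¹) * Ψ ^ 2 / 2)) * ((1 - θ) ^ (-(κ * (1 + τ) * γ / (2 * θ)))) ^ v) *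
      ((Δ : ℝ) + 1) ^ 2 ≤ 1 / 2) (C : Finset V) :
    pertZ (multivariateGaussian 0 Γ) (fun p ω => g p (ω + ψ)) C ≠ 0 :=
  regulated_pertZ_ne_zero hΓ hΓop hdiag hγ hfr cell hdisj hv hRsymm hR hΔ hnbr (mul_nonneg hε (exp_pos _).le)
    (mul_nonneg hκ (by linarith)) hθ0 hθ1 hκθ (shifted_measurable cell hmeas ψ)
    (shifted_regulated_of_small cell hε hκ hτ hreg ψ hψ) hsmall C

/-- **THE END — ON THE SMALL-EXTERNAL-FIELD REGION THE SHIFTED `log Z` IS EXTENSIVE, UNIFORMLY IN THE VOLUME AND IN THE EXTERNAL FIELD.**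
`Γ ⪰ 0`, `Γ ⪯ γ_op·1`, diagonal `≤ γ` (`γ ≥ 0`); disjoint cells of `≤ v` sites; a symmetric adjacency with `≤ Δ` neighbours; regulated
factors (`0 ≤ ε`, `0 ≤ κ`); `0 < τ`, `0 < θ < 1`, `κ(1+τ)γ_op ≤ θ`; an external field with `Σ_{x∈cell p}ψ_x² ≤ Ψ²` on every cell;
`e·ε_ΨA_τ^v·(Δ+1)² ≤ 1∕2` with `ε_Ψ = εe^{½κ(1+τ⁻¹)Ψ²}`, `A_τ = (1−θ)^{−κ(1+τ)γ∕(2θ)}` ⟹ `‖log Z_ψ(C)‖ ≤ #C·(Δ+1)·2e·ε_ΨA_τ^v`. [folklore] -/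
theorem shifted_norm_pertLogZ_le [DecidableEq V] {Γ : Matrix ι ι ℝ} {γop γ : ℝ} (hΓ : Γ.PosSemidef)
    (hΓop : (γop • (1 : Matrix ι ι ℝ) - Γ).PosSemidef) (hdiag : ∀ i, Γ i i ≤ γ) (hγ : 0 ≤ γ) (cell : V → Finset ι)
    (hdisj : ∀ p q, p ≠ q → Disjoint (cell p) (cell q)) {v : ℕ} (hv : ∀ p, (cell p).card ≤ v) {R : V → V → Prop} [DecidableRel R]
    (hRsymm : ∀ x y, R x y → R y x) {nbr : V → Finset V} {Δ : ℕ} (hΔ : ∀ x, (nbr x).card ≤ Δ) (hnbr : ∀ x y, R x y → y ∈ nbr x)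
    {g : V → EuclideanSpace ℝ ι → ℂ} {ε κ τ θ Ψ : ℝ} (hε : 0 ≤ ε) (hκ : 0 ≤ κ) (hτ : 0 < τ) (hθ0 : 0 < θ) (hθ1 : θ < 1)
    (hκθ : κ * (1 + τ) * γop ≤ θ) (hreg : ∀ p ω, ‖g p ω‖ ≤ ε * exp (κ * (∑ x ∈ cell p, ω x ^ 2) / 2)) (ψ : EuclideanSpace ℝ ι)
    (hψ : ∀ p, ∑ x ∈ cell p, ψ x ^ 2 ≤ Ψ ^ 2)
    (hsmall : Real.exp 1 * ((ε * exp (κ * (1 + τ⁻¹) * Ψ ^ 2 / 2)) * ((1 - θ) ^ (-(κ * (1 + τ) * γ / (2 * θ)))) ^ v) *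
      ((Δ : ℝ) + 1) ^ 2 ≤ 1 / 2) (C : Finset V) :
    ‖pertLogZ (multivariateGaussian 0 Γ) (fun p ω => g p (ω + ψ)) R C‖ ≤
      C.card * ((Δ : ℝ) + 1) *
        (2 * (Real.exp 1 * ((ε * exp (κ * (1 + τ⁻¹) * Ψ ^ 2 / 2)) * ((1 - θ) ^ (-(κ * (1 + τ) * γ / (2 * θ)))) ^ v))) :=
  regulated_norm_pertLogZ_le hΓ hΓop hdiag hγ cell hdisj hv hRsymm hΔ hnbr (mul_nonneg hε (exp_pos _).le)
    (mul_nonneg hκ (by linarith)) hθ0 hθ1 hκθ (shifted_regulated_of_small cell hε hκ hτ hreg ψ hψ) hsmall C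

/-! ## §5. Toy -/

/-- Toy (§1): with `τ = 1`, `(a+b)² ≤ 2a² + 2b²`. -/
example (a b : ℝ) : (a + b) ^ 2 ≤ (1 + 1) * a ^ 2 + (1 + (1 : ℝ)⁻¹) * b ^ 2 := young_sq a b one_pos

end Summit.QuantumFields.BalabanUV.T4Continuum.NE7b.SupRegulatedActivityShift
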